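import Summits.ResolutionOfSingularities.ResolutionOfSingularities.Theorems.HilbertSamuelEliminationSigmaMaxModificationsCorridor3WLadderSegmentsAssemblyA
import Summits.ResolutionOfSingularities.ResolutionOfSingularities.Theorems.HilbertSamuelEliminationSigmaMaxModificationsCorridor3WLadderSegmentsTowerEndsU
import Summits.ResolutionOfSingularities.ResolutionOfSingularities.Theorems.HilbertSamuelEliminationSigmaMaxModificationsCorridor3WLadderRecognitionNearLocusUnit
import Summits.ResolutionOfSingularities.ResolutionOfSingularities.Theorems.HilbertSamuelEliminationSigmaMaxModificationsCorridor3WLadderCharHypothesis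
import HarnessLib

/-!
# [OURS · L1 W4.2] RECOGNITION ASSEMBLY, STEP B: clauses (iv), (v) of Def. 6.38 on the unit tower from stub-2's unit-level geometry, and
# THE PURE-GEOMETRY ROW `Seg.UnitGeometryAtQM p (QCharRegime p)` — hence the (F1)-regime extraction `UnitTowerExtractionLocQM p` —
# MODULO THE FIVE PRINTED FACTS
# (crux `SigmaMaxModifications` stmt-ResolutionOfSingularities-18506; conjunct `SigmaMaxModificationsCorridor3` stmt-…-19249; line `w_ladder`)

Stub worker res-L1-w42-stub-1 (gen 4). Helper file `--supports stmt-ResolutionOfSingularities-19249 --as helper`; kernel only, no new definition.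

* `Seg.nearLocus_unitTowerU`, `Seg.hsFun_unitTowerU`, `Seg.isClosed_hsStratumGE_unitTowerU` (transport to the chain);
* `Seg.not_isolated_of_isIrreducible_infinite` (topology), `Seg.exists_nearPt_unitTowerU` (a closed near point at every kept stage, not isolated
  inside the unit), `Seg.exists_isolated_nearPt_unitTowerU_terminal` (isolated at the terminal stage);
* `Seg.inducesIsoOn_unitTowerU_of_printedFacts` ((iv)), `Seg.not_subset_image_unitTowerU_of_printedFacts` ((v));
* **`Seg.unitGeometryAtQM_of_printedFacts : UnitGeometryAtQM p (QCharRegime p)`** and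
  **`Moving.unitTowerExtractionLocQM_of_printedFacts : UnitTowerExtractionLocQM p`** — the char row's `hext`, modulo `Thm314_point_locus`,
  `CossartJannsenSaito2020_thm_3_14`, `Thm314_nearFibre_subsingleton`, `CossartJannsenSaito2020_thm_3_6`, `CossartJannsenSaito2020_thm_3_10_4`.

OURS bookkeeping; NOT a statement of the manuscript [Hironaka2017] nor of [CossartJannsenSaito2020]. AI-written; AI review is weaker than expert review.

References: V. Cossart, U. Jannsen, S. Saito, LNM 2270 (2020), Thm. 3.14, Lemma 6.33, Def. 6.34, Def. 6.38, Def. 6.39, Thm. 6.40 [CossartJannsenSaito2020].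
-/

noncomputable section

set_option linter.dupNamespace false -- namespace `…Corridor3.Moving` re-enters `…Corridor3` (module convention of the Moving files)

open CategoryTheory AlgebraicGeometry TopologicalSpace Topology IsLocalRing
open Literature.AlgebraicGeometry.Resolution Literature.RingTheory.HilbertSamuel
open Literature.AlgebraicGeometry.CossartJannsenSaito2020
open Summit.ResolutionOfSingularities.ResolutionOfSingularities.Theorems.CampaignW42
open Summit.ResolutionOfSingularities.ResolutionOfSingularities.Theorems.SigmaMaxModificationsCorridor3.Helpers

namespace Summit.ResolutionOfSingularities.ResolutionOfSingularities.Theorems.SigmaMaxModificationsCorridor3.Moving.Seg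

/-- **A closed point of an infinite irreducible closed set is not isolated in it.** [folklore] -/
theorem not_isolated_of_isIrreducible_infinite {α : Type*} [TopologicalSpace α] {M : Set α} (hMcl : IsClosed M) (hirr : IsIrreducible M)
    (hinf : M.Infinite) {z : α} (hzcl : IsClosed ({z} : Set α)) : ¬ ∃ U : Set α, IsOpen U ∧ U ∩ M = {z} := by
  rintro ⟨U, hUo, hUM⟩
  have hcov : M ⊆ (M ∩ Uᶜ) ∪ {z} := by
    intro y hy
    by_cases hyU : y ∈ U
    · exact Or.inr (hUM.subset ⟨hyU, hy⟩)
    · exact Or.inl ⟨hy, hyU⟩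
  rcases isPreirreducible_iff_isClosed_union_isClosed.mp hirr.isPreirreducible _ _ (hMcl.inter hUo.isClosed_compl) hzcl hcov with h | h
  · have hzM : z ∈ U ∩ M := hUM.symm.subset (Set.mem_singleton z)
    exact (h hzM.2).2 hzM.1
  · exact hinf ((Set.finite_singleton z).subset h)

section Unit

variable {R : ∀ S : Scheme.{0}, CentreSeq S → Prop} {N : ℕ} {ν : ℕ → ℕ} {k : Type} [Field k]
  {c : ℕ → MarkedStage.{0}} (hc : ∀ n, CanonicalNearStep R N ν (c n) (c (n + 1))) (hRf : OracleFunctional R) (hRa : OracleAdmissible R)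
  (hν : ν ≠ iterPSum N Phi) (h0 : Helpers.CycleInv k N ν (c 0)) (hgen : ∀ n, ∃ m, n ≤ m ∧ (c m).IsBlownUp R N ν)
  (hBG : ∀ n, ∃ m, n ≤ m ∧ (c m).IsBlownUp R N ν ∧ Iso N (c m))
  {p : ℕ} {X : Scheme.{0}} [IsLocallyNoetherian X] {x : X} (hX : IsMaximalOrigin p N ν X x)
  (hreach : Reaches R N ν (MarkedStage.init X x) (c 0))

/-- `N^{U}_q = ι⁻¹(N_{relIdxU q})` on the repaired unit tower. [cite: CossartJannsenSaito2020, Def. 6.34 (ii), p. 107] -/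
theorem nearLocus_unitTowerU {b : ℕ} (hemp : HEmpU hc hRa hν h0 hgen hBG b) (q : ℕ) :
    (unitTowerU hc hRa hν h0 hgen hBG b hemp).nearLocus N (basePt hc hRa hν h0 b) q =
      (locι hc hRa hν h0 b (Seg.relIdxU hgen hBG b q)).base ⁻¹' (upTower hc hRa hν h0 b).nearLocus N (c b).pt (Seg.relIdxU hgen hBG b q) := by
  haveI : IsLocallyNoetherian ((upTower hc hRa hν h0 b).X 0) := (upTower hc hRa hν h0 b).ln 0
  haveI := flat_fromSpecStalk ((upTower hc hRa hν h0 b).X 0) ((c b).pt : (upTower hc hRa hν h0 b).X 0)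
  have h1 : (unitTowerU hc hRa hν h0 hgen hBG b hemp).nearLocus N (basePt hc hRa hν h0 b) q =
      (locTower hc hRa hν h0 b).nearLocus N (basePt hc hRa hν h0 b) (Seg.relIdxU hgen hBG b q) :=
    (locTower hc hRa hν h0 b).nearLocus_compress_zero (htriv_of_hEmpU hc hRa hν h0 hgen hBG hemp) N (basePt hc hRa hν h0 b) q
  have h2 := (upTower hc hRa hν h0 b).nearLocus_baseChange
    (((upTower hc hRa hν h0 b).X 0).fromSpecStalk ((c b).pt : (upTower hc hRa hν h0 b).X 0)) N (basePt hc hRa hν h0 b) (Seg.relIdxU hgen hBG b q)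
  rw [show (((upTower hc hRa hν h0 b).X 0).fromSpecStalk ((c b).pt : (upTower hc hRa hν h0 b).X 0)).base (basePt hc hRa hν h0 b) = (c b).pt
    from Scheme.fromSpecStalk_closedPoint] at h2
  rw [h1]
  exact h2

/-- `H` on the repaired unit tower is `H` of the chain stage at the image point. [cite: CossartJannsenSaito2020, Lemma 2.27 (1)] -/
theorem hsFun_unitTowerU {b : ℕ} (hemp : HEmpU hc hRa hν h0 hgen hBG b) (q : ℕ) (y : (unitTowerU hc hRa hν h0 hgen hBG b hemp).X q) :
    Scheme.hsFun ((unitTowerU hc hRa hν h0 hgen hBG b hemp).X q) N y =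
      Scheme.hsFun (c (b + Seg.relIdxU hgen hBG b q)).W N ((locι hc hRa hν h0 b (Seg.relIdxU hgen hBG b q)).base y) := by
  haveI : IsLocallyNoetherian ((upTower hc hRa hν h0 b).X 0) := (upTower hc hRa hν h0 b).ln 0
  haveI := flat_fromSpecStalk ((upTower hc hRa hν h0 b).X 0) ((c b).pt : (upTower hc hRa hν h0 b).X 0)
  exact (upTower hc hRa hν h0 b).hsFun_baseChange _ N _ y

/-- The `H`-strata `X(≥ μ)` of every stage of the repaired unit tower are closed. [cite: CossartJannsenSaito2020, Lemma 2.36] -/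
theorem isClosed_hsStratumGE_unitTowerU {b : ℕ} (hemp : HEmpU hc hRa hν h0 hgen hBG b) (q : ℕ) (μ : ℕ → ℕ) :
    IsClosed (Scheme.hsStratumGE ((unitTowerU hc hRa hν h0 hgen hBG b hemp).X q) N μ) := by
  have hcyc : Helpers.CycleInv k N ν (c (b + Seg.relIdxU hgen hBG b q)) := cycleInv_at hc hRa hν h0 _
  have heq : Scheme.hsStratumGE ((unitTowerU hc hRa hν h0 hgen hBG b hemp).X q) N μ =
      (locι hc hRa hν h0 b (Seg.relIdxU hgen hBG b q)).base ⁻¹' Scheme.hsStratumGE (c (b + Seg.relIdxU hgen hBG b q)).W N μ := by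
    ext y
    have e := hsFun_unitTowerU hc hRa hν h0 hgen hBG hemp q y
    constructor
    · intro hy
      have hy' : μ ≤ Scheme.hsFun ((unitTowerU hc hRa hν h0 hgen hBG b hemp).X q) N y := Scheme.mem_hsStratumGE_iff.mp hy
      rw [e] at hy'
      exact Scheme.mem_hsStratumGE_iff.mpr hy'
    · intro hy
      have hy' : μ ≤ Scheme.hsFun (c (b + Seg.relIdxU hgen hBG b q)).W N ((locι hc hRa hν h0 b (Seg.relIdxU hgen hBG b q)).base y) :=
        Scheme.mem_hsStratumGE_iff.mp hy
      rw [← e] at hy'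
      exact Scheme.mem_hsStratumGE_iff.mpr hy'
  rw [heq]
  exact (isClosed_hsStratumGE_of_cycleInv hcyc μ).preimage (locι hc hRa hν h0 b _).continuous

include hX hreach in
/-- **A CLOSED NEAR POINT AT EVERY KEPT STAGE** of the repaired unit tower: the localised marked point `x_{b + relIdxU q}`. [cite: CossartJannsenSaito2020, Def. 6.34 (ii)] -/
theorem exists_nearPt_unitTowerU {b : ℕ} (hemp : HEmpU hc hRa hν h0 hgen hBG b) (q : ℕ) :
    ∃ s ∈ (unitTowerU hc hRa hν h0 hgen hBG b hemp).nearLocus N (basePt hc hRa hν h0 b) q,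
      (locι hc hRa hν h0 b (Seg.relIdxU hgen hBG b q)).base s = (c (b + Seg.relIdxU hgen hBG b q)).pt ∧
      IsClosed ({s} : Set ((unitTowerU hc hRa hν h0 hgen hBG b hemp).X q)) := by
  haveI : IsLocallyNoetherian ((upTower hc hRa hν h0 b).X 0) := (upTower hc hRa hν h0 b).ln 0
  obtain ⟨s, hs⟩ := (upTower hc hRa hν h0 b).mem_range_bcι_localize_of_phi_eq (c b).pt _ _ (upTower_phi_pt hc hRa hν h0 b (Seg.relIdxU hgen hBG b q))
  refine ⟨s, ?_, hs, ?_⟩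
  · have hs' : (locι hc hRa hν h0 b (Seg.relIdxU hgen hBG b q)).base s = (c (b + Seg.relIdxU hgen hBG b q)).pt := hs
    rw [nearLocus_unitTowerU hc hRa hν h0 hgen hBG hemp q]
    show (locι hc hRa hν h0 b (Seg.relIdxU hgen hBG b q)).base s ∈ (upTower hc hRa hν h0 b).nearLocus N (c b).pt (Seg.relIdxU hgen hBG b q)
    rw [hs']
    exact pt_mem_nearLocus hc hRa hν h0 hX hreach b _
  · refine (upTower hc hRa hν h0 b).isClosed_singleton_of_bcι _ _ s ?_
    rw [show ((upTower hc hRa hν h0 b).bcι _ _).base s = (c (b + Seg.relIdxU hgen hBG b q)).pt from hs]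
    exact Reaches.isClosed_pt hX.isClosed (reaches_chain hreach hc _)

include hRf hX hreach in
/-- **INSIDE THE UNIT THE NEAR POINT IS NOT ISOLATED** in the near locus (the stage is not `Iso`, so the near locus is an infinite irreducible curve).
[cite: CossartJannsenSaito2020, Def. 6.38 (iii), Rem. 6.29 (1)] -/
theorem exists_nearPt_not_isolated_unitTowerU (h314pt : Thm314_point_locus.{0}) (h314 : CossartJannsenSaito2020_thm_3_14.{0})
    (h314f : Thm314_nearFibre_subsingleton.{0}) (h36 : CossartJannsenSaito2020_thm_3_6.{0}) (h3104 : CossartJannsenSaito2020_thm_3_10_4.{0})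
    (b : ℕ) (hb : (c b).IsBlownUp R N ν) (hiso : Iso N (c b)) (hchar : CharHypothesis (c b).W (c b).pt) (he : dirDim (c b) = 2)
    (hē : (c b).geomDirDim ≤ 2) (hemp : HEmpU hc hRa hν h0 hgen hBG b) {q : ℕ} (hq1 : 1 ≤ q) (hq : q < unitLen hgen hBG b) :
    ∃ s ∈ (unitTowerU hc hRa hν h0 hgen hBG b hemp).nearLocus N (basePt hc hRa hν h0 b) q,
      IsClosed ({s} : Set ((unitTowerU hc hRa hν h0 hgen hBG b hemp).X q)) ∧
      ¬ ∃ U : Set ((unitTowerU hc hRa hν h0 hgen hBG b hemp).X q), IsOpen U ∧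
        U ∩ (unitTowerU hc hRa hν h0 hgen hBG b hemp).nearLocus N (basePt hc hRa hν h0 b) q = {s} := by
  haveI : IsLocallyNoetherian ((upTower hc hRa hν h0 b).X 0) := (upTower hc hRa hν h0 b).ln 0
  obtain ⟨k', _, _, hg⟩ := hX.exists_stateGood_of_reaches hRa hν (reaches_chain hreach hc b)
  have hU := stratumIsolated_of_iso hg hiso
  obtain ⟨s, hs, -, hscl⟩ := exists_nearPt_unitTowerU hc hRa hν h0 hgen hBG hX hreach hemp q
  refine ⟨s, hs, hscl, ?_⟩
  -- the chain's near locus at the kept stage is infinite irreducible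
  have hn : Seg.relIdxU hgen hBG b q = Seg.relIdx hgen b q := Seg.relIdxU_eq_of_le hgen hBG b hq.le
  have hnotG : ¬ Iso N (c (b + Seg.relIdxU hgen hBG b q)) := by
    rw [hn]; exact Seg.not_G_add_relIdx_of_lt_relLen hgen hBG b hq1 hq
  have hpos : 0 < Seg.relIdxU hgen hBG b q := by
    rw [hn]
    have := BlowupTower.cidx_strictMono 0 (Seg.relGap hgen b) (Nat.lt_of_lt_of_le Nat.zero_lt_one hq1)
    simpa using this
  have hlt : Seg.relIdxU hgen hBG b q < Seg.relIdxU hgen hBG b (Seg.relLen hgen hBG b) := by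
    rw [hn, Seg.relIdxU_eq_of_le hgen hBG b le_rfl]
    exact BlowupTower.cidx_strictMono 0 (Seg.relGap hgen b) hq
  have hDR := dich_regN_of_printedFacts hc hRf hRa hν h0 hgen hBG hX hreach h314pt h314 h314f h36 h3104 b hb hiso hchar he hē
  obtain ⟨hinf, hirr⟩ := infinite_irreducible_nearLocus_of_not_iso hc hRa hν h0 hX hreach b hU _ hnotG (hDR.1 _ hpos hlt)
  have hrange : (upTower hc hRa hν h0 b).nearLocus N (c b).pt (Seg.relIdxU hgen hBG b q) ⊆ Set.range (locι hc hRa hν h0 b (Seg.relIdxU hgen hBG b q)).base := by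
    have h := BlowupTowerNear.nearLocus_subset_range_bcι (upTower hc hRa hν h0 b)
      (((upTower hc hRa hν h0 b).X 0).fromSpecStalk ((c b).pt : (upTower hc hRa hν h0 b).X 0)) N (basePt hc hRa hν h0 b) (Seg.relIdxU hgen hBG b q)
    rw [show (((upTower hc hRa hν h0 b).X 0).fromSpecStalk ((c b).pt : (upTower hc hRa hν h0 b).X 0)).base (basePt hc hRa hν h0 b) = (c b).pt
      from Scheme.fromSpecStalk_closedPoint] at h
    exact h
  have hemb : Topology.IsEmbedding (locι hc hRa hν h0 b (Seg.relIdxU hgen hBG b q)).base :=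
    @Scheme.Hom.isEmbedding _ _ (locι hc hRa hν h0 b (Seg.relIdxU hgen hBG b q))
      ((upTower hc hRa hν h0 b).isPreimmersion_bcι (((upTower hc hRa hν h0 b).X 0).fromSpecStalk ((c b).pt : (upTower hc hRa hν h0 b).X 0)) _)
  have hNeq := nearLocus_unitTowerU hc hRa hν h0 hgen hBG hemp q (N := N)
  have hirrT : IsIrreducible ((unitTowerU hc hRa hν h0 hgen hBG b hemp).nearLocus N (basePt hc hRa hν h0 b) q) := by
    rw [hNeq]; exact isIrreducible_preimage_of_isEmbedding hemb hirr hrange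
  have hinfT : ((unitTowerU hc hRa hν h0 hgen hBG b hemp).nearLocus N (basePt hc hRa hν h0 b) q).Infinite := by
    rw [hNeq]
    intro hfin
    exact hinf ((Set.image_preimage_eq_of_subset hrange) ▸ hfin.image _)
  have hclT : IsClosed ((unitTowerU hc hRa hν h0 hgen hBG b hemp).nearLocus N (basePt hc hRa hν h0 b) q) := by
    rw [hNeq]; exact (isClosed_nearLocus hc hRa hν h0 hX hreach b _).preimage (locι hc hRa hν h0 b _).continuous
  exact not_isolated_of_isIrreducible_infinite hclT hirrT hinfT hscl

include hX hreach in
/-- **AT THE TERMINAL STAGE THE NEAR POINT IS ISOLATED** in the near locus (the terminal stage is `Iso`). [cite: CossartJannsenSaito2020, Def. 6.38 (vi)] -/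
theorem exists_isolated_nearPt_unitTowerU_terminal {b : ℕ} (hemp : HEmpU hc hRa hν h0 hgen hBG b) :
    ∃ s ∈ (unitTowerU hc hRa hν h0 hgen hBG b hemp).nearLocus N (basePt hc hRa hν h0 b) (unitLen hgen hBG b),
      IsClosed ({s} : Set ((unitTowerU hc hRa hν h0 hgen hBG b hemp).X (unitLen hgen hBG b))) ∧
      ∃ U : Set ((unitTowerU hc hRa hν h0 hgen hBG b hemp).X (unitLen hgen hBG b)), IsOpen U ∧
        U ∩ (unitTowerU hc hRa hν h0 hgen hBG b hemp).nearLocus N (basePt hc hRa hν h0 b) (unitLen hgen hBG b) = {s} := by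
  haveI : IsLocallyNoetherian ((upTower hc hRa hν h0 b).X 0) := (upTower hc hRa hν h0 b).ln 0
  obtain ⟨s, hs, hιs, hscl⟩ := exists_nearPt_unitTowerU hc hRa hν h0 hgen hBG hX hreach hemp (unitLen hgen hBG b)
  refine ⟨s, hs, hscl, ?_⟩
  -- the terminal chain stage `b + relIdxU (unitLen) = nextBaseU b` is `Iso`
  have hG : Iso N (c (b + Seg.relIdxU hgen hBG b (unitLen hgen hBG b))) := Seg.G_nextBaseU hgen hBG b
  obtain ⟨k', _, _, hg⟩ := hX.exists_stateGood_of_reaches hRa hν (reaches_chain hreach hc (b + Seg.relIdxU hgen hBG b (unitLen hgen hBG b)))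
  obtain ⟨U, hUo, hptU, hUsub⟩ := stratumIsolated_of_iso hg hG
  refine ⟨(locι hc hRa hν h0 b _).base ⁻¹' U, hUo.preimage (locι hc hRa hν h0 b _).continuous, ?_⟩
  have hinj := (upTower hc hRa hν h0 b).bcι_injective (((upTower hc hRa hν h0 b).X 0).fromSpecStalk ((c b).pt : (upTower hc hRa hν h0 b).X 0))
    (Seg.relIdxU hgen hBG b (unitLen hgen hBG b))
  refine Set.Subset.antisymm ?_ ?_
  · rintro y ⟨hyU, hyN⟩
    have hyN' : (locι hc hRa hν h0 b _).base y ∈ (upTower hc hRa hν h0 b).nearLocus N (c b).pt (Seg.relIdxU hgen hBG b (unitLen hgen hBG b)) := by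
      rw [nearLocus_unitTowerU hc hRa hν h0 hgen hBG hemp] at hyN; exact hyN
    have h1 : (locι hc hRa hν h0 b _).base y ∈ ({(c (b + Seg.relIdxU hgen hBG b (unitLen hgen hBG b))).pt} : Set _) :=
      hUsub ⟨hyU, nearLocus_subset_hsStratum hc hRa hν h0 hX hreach b _ hyN'⟩
    exact Set.mem_singleton_iff.mpr (hinj (h1.trans hιs.symm))
  · rintro y hy
    rw [Set.mem_singleton_iff.mp hy]
    exact ⟨show (locι hc hRa hν h0 b _).base s ∈ U by rw [hιs]; exact hptU, hs⟩

include hRf hX hreach in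
/-- **Def. 6.38 (iv) ON THE UNIT TOWER FROM THE PRINTED FACTS**: `π_{j+1} : C_{j+1} ⥲ C_j` for `1 ≤ j`, `j + 1 < unitLen` (stub-2's
`inducesIsoOn_of_unit`, fed with (ii)′, (iii), a closed non-isolated near point inside the unit). [cite: CossartJannsenSaito2020, Def. 6.38 (iv), Lemma 6.33] -/
theorem inducesIsoOn_unitTowerU_of_printedFacts (h314pt : Thm314_point_locus.{0}) (h314 : CossartJannsenSaito2020_thm_3_14.{0})
    (h314f : Thm314_nearFibre_subsingleton.{0}) (h36 : CossartJannsenSaito2020_thm_3_6.{0}) (h3104 : CossartJannsenSaito2020_thm_3_10_4.{0})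
    (b : ℕ) (hb : (c b).IsBlownUp R N ν) (hiso : Iso N (c b)) (hchar : CharHypothesis (c b).W (c b).pt)
    (h22 : ∀ n, Iso N (c n) → dirDim (c n) = 2 ∧ (c n).geomDirDim = 2) (hemp : HEmpU hc hRa hν h0 hgen hBG b) :
    ∀ j : ℕ, 1 ≤ j → j + 1 < unitLen hgen hBG b →
      InducesIsoOn ((unitTowerU hc hRa hν h0 hgen hBG b hemp).π j) ((unitTowerU hc hRa hν h0 hgen hBG b hemp).C (j + 1))
        ((unitTowerU hc hRa hν h0 hgen hBG b hemp).isClosed_C (j + 1)) ((unitTowerU hc hRa hν h0 hgen hBG b hemp).C j)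
        ((unitTowerU hc hRa hν h0 hgen hBG b hemp).isClosed_C j) := by
  intro j hj hj1
  haveI : IsLocallyNoetherian ((upTower hc hRa hν h0 b).X 0) := (upTower hc hRa hν h0 b).ln 0
  haveI : IsLocallyNoetherian (c b).W := (c b).ln
  haveI hNoe : IsNoetherian ((unitTowerU hc hRa hν h0 hgen hBG b hemp).X 0) := by
    show IsNoetherian (Spec ((c b).W.presheaf.stalk (c b).pt)); infer_instance
  obtain ⟨k', _, _, hg⟩ := hX.exists_stateGood_of_reaches hRa hν (reaches_chain hreach hc b)
  have hU := stratumIsolated_of_iso hg hiso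
  have he := (h22 b hiso).1
  have hē := (h22 b hiso).2.le
  have hkey := keySetting_unitTowerU hc hRa hν h0 hgen hBG b hemp (N := N)
  have hperm := isPermissible_centreIdeal_unitTowerU hc hRa hν h0 hgen hBG b hemp (N := N)
  have hcl := isClosed_hsStratumGE_unitTowerU hc hRa hν h0 hgen hBG hemp (N := N)
  have hx : IsClosed ({basePt hc hRa hν h0 b} : Set ((unitTowerU hc hRa hν h0 hgen hBG b hemp).X 0)) := isClosed_singleton_closedPoint _
  have hcharT := charHypothesis_unitTowerU hc hRa hν h0 hgen hBG b hemp hchar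
  have heT : (unitTowerU hc hRa hν h0 hgen hBG b hemp).dirDimAt 0 (basePt hc hRa hν h0 b) = 2 :=
    (dirDimAt_unitTowerU_zero hc hRa hν h0 hgen hBG b hemp).trans he
  have hēT : (unitTowerU hc hRa hν h0 hgen hBG b hemp).geomDirDimAt 0 (basePt hc hRa hν h0 b) ≤ 2 :=
    (geomDirDimAt_unitTowerU_zero hc hRa hν h0 hgen hBG b hemp).trans_le hē
  have hC0 := unitTowerU_C_zero hc hRa hν h0 hgen hBG hRf hX b hemp (reaches_chain hreach hc b) hb hU
  have hDR := dich_regN_of_printedFacts hc hRf hRa hν h0 hgen hBG hX hreach h314pt h314 h314f h36 h3104 b hb hiso hchar he hē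
  have hC1 := unitTowerU_C_one_eq_projDir hc hRf hRa hν h0 hgen hBG hX hreach h314pt b hb hiso hchar h22 hDR.1 hDR.2 hemp (by omega)
  obtain ⟨s1, hs1, -⟩ := exists_nearPt_unitTowerU hc hRa hν h0 hgen hBG hX hreach hemp 1
  have hCq : ∀ i, 2 ≤ i → i ≤ unitLen hgen hBG b - 1 →
      (unitTowerU hc hRa hν h0 hgen hBG b hemp).C i = (unitTowerU hc hRa hν h0 hgen hBG b hemp).nearLocus N (basePt hc hRa hν h0 b) i :=
    fun i _ hi => unitTowerU_C_eq_nearLocus hc hRf hRa hν h0 hgen hBG hX hreach b hb hiso hDR.1 hDR.2 hemp (by omega)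
  have hniso : ∀ i, 2 ≤ i → i ≤ unitLen hgen hBG b - 1 →
      ∃ z ∈ (unitTowerU hc hRa hν h0 hgen hBG b hemp).nearLocus N (basePt hc hRa hν h0 b) i,
        IsClosed ({z} : Set ((unitTowerU hc hRa hν h0 hgen hBG b hemp).X i)) ∧
        ¬ ∃ U : Set ((unitTowerU hc hRa hν h0 hgen hBG b hemp).X i), IsOpen U ∧
          U ∩ (unitTowerU hc hRa hν h0 hgen hBG b hemp).nearLocus N (basePt hc hRa hν h0 b) i = {z} :=
    fun i hi2 hi => exists_nearPt_not_isolated_unitTowerU hc hRf hRa hν h0 hgen hBG hX hreach h314pt h314 h314f h36 h3104 b hb hiso hchar he hē hemp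
      (by omega) (by omega)
  exact BlowupTowerNear.inducesIsoOn_of_unit (T := unitTowerU hc hRa hν h0 hgen hBG b hemp) h314pt h314 h314f h36 h3104 hkey hperm hcl hx hcharT
    heT hēT hC0 hC1 ⟨s1, hs1⟩ hCq hniso j hj (by omega)

include hRf hX hreach in
/-- **Def. 6.38 (v) ON THE UNIT TOWER FROM THE PRINTED FACTS**: at the end of the unit (`unitLen = j + 1`, `1 ≤ j`) the blow-down does NOT map
`N_{j+1}` onto `C_j` (stub-2's `not_surjective_of_unit`, the marked point at the terminal `Iso` stage being closed and isolated in its near locus).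
[cite: CossartJannsenSaito2020, Def. 6.38 (v)–(vi)] -/
theorem not_subset_image_unitTowerU_of_printedFacts (h314pt : Thm314_point_locus.{0}) (h314 : CossartJannsenSaito2020_thm_3_14.{0})
    (h314f : Thm314_nearFibre_subsingleton.{0}) (h36 : CossartJannsenSaito2020_thm_3_6.{0}) (h3104 : CossartJannsenSaito2020_thm_3_10_4.{0})
    (b : ℕ) (hb : (c b).IsBlownUp R N ν) (hiso : Iso N (c b)) (hchar : CharHypothesis (c b).W (c b).pt)
    (h22 : ∀ n, Iso N (c n) → dirDim (c n) = 2 ∧ (c n).geomDirDim = 2) (hemp : HEmpU hc hRa hν h0 hgen hBG b) :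
    ∀ j : ℕ, 1 ≤ j → unitLen hgen hBG b = j + 1 →
      ¬ ((unitTowerU hc hRa hν h0 hgen hBG b hemp).C j ⊆ ((unitTowerU hc hRa hν h0 hgen hBG b hemp).π j).base ''
        (unitTowerU hc hRa hν h0 hgen hBG b hemp).nearLocus N (basePt hc hRa hν h0 b) (j + 1)) := by
  intro j hj hlen
  haveI : IsLocallyNoetherian ((upTower hc hRa hν h0 b).X 0) := (upTower hc hRa hν h0 b).ln 0
  haveI : IsLocallyNoetherian (c b).W := (c b).ln
  haveI hNoe : IsNoetherian ((unitTowerU hc hRa hν h0 hgen hBG b hemp).X 0) := by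
    show IsNoetherian (Spec ((c b).W.presheaf.stalk (c b).pt)); infer_instance
  obtain ⟨k', _, _, hg⟩ := hX.exists_stateGood_of_reaches hRa hν (reaches_chain hreach hc b)
  have hU := stratumIsolated_of_iso hg hiso
  have he := (h22 b hiso).1
  have hē := (h22 b hiso).2.le
  have hkey := keySetting_unitTowerU hc hRa hν h0 hgen hBG b hemp (N := N)
  have hperm := isPermissible_centreIdeal_unitTowerU hc hRa hν h0 hgen hBG b hemp (N := N)
  have hcl := isClosed_hsStratumGE_unitTowerU hc hRa hν h0 hgen hBG hemp (N := N)
  have hx : IsClosed ({basePt hc hRa hν h0 b} : Set ((unitTowerU hc hRa hν h0 hgen hBG b hemp).X 0)) := isClosed_singleton_closedPoint _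
  have hcharT := charHypothesis_unitTowerU hc hRa hν h0 hgen hBG b hemp hchar
  have heT : (unitTowerU hc hRa hν h0 hgen hBG b hemp).dirDimAt 0 (basePt hc hRa hν h0 b) = 2 :=
    (dirDimAt_unitTowerU_zero hc hRa hν h0 hgen hBG b hemp).trans he
  have hēT : (unitTowerU hc hRa hν h0 hgen hBG b hemp).geomDirDimAt 0 (basePt hc hRa hν h0 b) ≤ 2 :=
    (geomDirDimAt_unitTowerU_zero hc hRa hν h0 hgen hBG b hemp).trans_le hē
  have hC0 := unitTowerU_C_zero hc hRa hν h0 hgen hBG hRf hX b hemp (reaches_chain hreach hc b) hb hU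
  have hDR := dich_regN_of_printedFacts hc hRf hRa hν h0 hgen hBG hX hreach h314pt h314 h314f h36 h3104 b hb hiso hchar he hē
  have hC1 := unitTowerU_C_one_eq_projDir hc hRf hRa hν h0 hgen hBG hX hreach h314pt b hb hiso hchar h22 hDR.1 hDR.2 hemp (by omega)
  obtain ⟨s1, hs1, -⟩ := exists_nearPt_unitTowerU hc hRa hν h0 hgen hBG hX hreach hemp 1
  have hCq : ∀ i, 2 ≤ i → i ≤ j →
      (unitTowerU hc hRa hν h0 hgen hBG b hemp).C i = (unitTowerU hc hRa hν h0 hgen hBG b hemp).nearLocus N (basePt hc hRa hν h0 b) i :=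
    fun i _ hi => unitTowerU_C_eq_nearLocus hc hRf hRa hν h0 hgen hBG hX hreach b hb hiso hDR.1 hDR.2 hemp (by omega)
  have hniso : ∀ i, 2 ≤ i → i ≤ j →
      ∃ z ∈ (unitTowerU hc hRa hν h0 hgen hBG b hemp).nearLocus N (basePt hc hRa hν h0 b) i,
        IsClosed ({z} : Set ((unitTowerU hc hRa hν h0 hgen hBG b hemp).X i)) ∧
        ¬ ∃ U : Set ((unitTowerU hc hRa hν h0 hgen hBG b hemp).X i), IsOpen U ∧
          U ∩ (unitTowerU hc hRa hν h0 hgen hBG b hemp).nearLocus N (basePt hc hRa hν h0 b) i = {z} :=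
    fun i hi2 hi => exists_nearPt_not_isolated_unitTowerU hc hRf hRa hν h0 hgen hBG hX hreach h314pt h314 h314f h36 h3104 b hb hiso hchar he hē hemp
      (by omega) (by omega)
  have key : ∀ m, m = unitLen hgen hBG b →
      ∃ s ∈ (unitTowerU hc hRa hν h0 hgen hBG b hemp).nearLocus N (basePt hc hRa hν h0 b) m,
        IsClosed ({s} : Set ((unitTowerU hc hRa hν h0 hgen hBG b hemp).X m)) ∧
        ∃ U : Set ((unitTowerU hc hRa hν h0 hgen hBG b hemp).X m), IsOpen U ∧
          U ∩ (unitTowerU hc hRa hν h0 hgen hBG b hemp).nearLocus N (basePt hc hRa hν h0 b) m = {s} := by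
    rintro m rfl
    exact exists_isolated_nearPt_unitTowerU_terminal hc hRa hν h0 hgen hBG hX hreach hemp (N := N)
  obtain ⟨z, -, hzcl, hisoz⟩ := key (j + 1) hlen.symm
  exact BlowupTowerNear.not_surjective_of_unit (T := unitTowerU hc hRa hν h0 hgen hBG b hemp) h314pt h314f h36 h3104 hkey hperm hcl hx hcharT
    heT hēT hC0 hC1 ⟨s1, hs1⟩ hj hCq hniso hzcl hisoz

end Unit

/-! ## The pure-geometry row and the (F1)-regime extraction, modulo the five printed facts -/

/-- **THE PURE-GEOMETRY ROW `Seg.UnitGeometryAtQM p (QCharRegime p)` FROM THE FIVE PRINTED FACTS** ((Dich)/(RegN): Step A; (ii)′: `…CentreOne`;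
(iv), (v): above; (F1) along the chain from the regime `QCharRegime`). [cite: CossartJannsenSaito2020, Thm. 3.14, Lemma 6.33, Def. 6.34, Def. 6.38] -/
theorem unitGeometryAtQM_of_printedFacts (p : ℕ) (h314pt : Thm314_point_locus.{0}) (h314 : CossartJannsenSaito2020_thm_3_14.{0})
    (h314f : Thm314_nearFibre_subsingleton.{0}) (h36 : CossartJannsenSaito2020_thm_3_6.{0}) (h3104 : CossartJannsenSaito2020_thm_3_10_4.{0}) :
    UnitGeometryAtQM p (QCharRegime p) := by
  intro R hRf hRa ν X _ x hX hq c hreach hc hēall hgen hIso h22 k _ h0 hν hBG b hb hiso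
  have hchar : CharHypothesis (c b).W (c b).pt := charHypothesis_of_chain hX hq hreach hc b (c b).pt
  have hDR := dich_regN_of_printedFacts hc hRf hRa hν h0 hgen hBG hX hreach h314pt h314 h314f h36 h3104 b hb hiso hchar (h22 b hiso).1 (h22 b hiso).2.le
  refine ⟨hDR.1, hDR.2, fun h2 => ?_, ?_, ?_⟩
  · exact unitTowerU_C_one_eq_projDir hc hRf hRa hν h0 hgen hBG hX hreach h314pt b hb hiso hchar h22 hDR.1 hDR.2 _ h2
  · exact inducesIsoOn_unitTowerU_of_printedFacts hc hRf hRa hν h0 hgen hBG hX hreach h314pt h314 h314f h36 h3104 b hb hiso hchar h22 _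
  · exact not_subset_image_unitTowerU_of_printedFacts hc hRf hRa hν h0 hgen hBG hX hreach h314pt h314 h314f h36 h3104 b hb hiso hchar h22 _

/-- **THE (F1)-REGIME UNIT-TOWER EXTRACTION `UnitTowerExtractionLocQM p` FROM THE FIVE PRINTED FACTS** — the `hext` input of the char row's
`Moving.wlow3CharM_of_printed_of_constructionsLoc`. [cite: CossartJannsenSaito2020, Def. 6.38, Def. 6.39, Thm. 6.40, p. 107] -/
theorem _root_.Summit.ResolutionOfSingularities.ResolutionOfSingularities.Theorems.SigmaMaxModificationsCorridor3.Moving.unitTowerExtractionLocQM_of_printedFacts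
    (p : ℕ) (h314pt : Thm314_point_locus.{0}) (h314 : CossartJannsenSaito2020_thm_3_14.{0}) (h314f : Thm314_nearFibre_subsingleton.{0})
    (h36 : CossartJannsenSaito2020_thm_3_6.{0}) (h3104 : CossartJannsenSaito2020_thm_3_10_4.{0}) : UnitTowerExtractionLocQM p :=
  unitTowerExtractionLocQM_of_geometry p (unitGeometryAtQM_of_printedFacts p h314pt h314 h314f h36 h3104)

end Summit.ResolutionOfSingularities.ResolutionOfSingularities.Theorems.SigmaMaxModificationsCorridor3.Moving.Seg

end
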